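import Summits.AtomisticToContinuum.HydrodynamicLimit.Theorems.ImplosionDichotomyPolynomialCompressionUniquenessIdentity

/-!
# Transport of the symmetrising weights along a hard-sphere Euler solution

Helper file for the line `log-lipschitz-budget` of the crux
`ImplosionDichotomy.PolynomialCompression` (stub `stub_logBudgetShadowing`: the coefficients of
the frozen-coefficient energy identity are of Type I). For a classical solution
`IsHardSphereEulerSolution σ T ρ u θ` with pressure field `p = ρ θ ζ(ρ)` (`ζ` smooth on an open
set `J ⊆ ℝ` containing the values of the density) the linearised system is symmetrised by the
weights `A = θ γ(ρ)/ρ` (`γ = ζ + id·ζ' = ∂_ρ p/θ`) and `B = 3ρ/(2θ)`, and the frozen-coefficient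
energy identity (`hsEuler_frozen_energy_identity`) has the zero-order coefficients
`∂ₜA + u·∇A + A div u`, `∂ₜB + u·∇B + B div u`, `∇(θ γ(ρ))`, `∇(ρ ζ(ρ))`. Here they are made
explicit, pointwise on `[0, T) × 𝕋³`:

* `hsEuler_weightA_transport` —
  `∂ₜA + u·∇A + A div u = (A (2 - (2/3) ζ(ρ)) - θ (2ζ'(ρ) + ρ ζ''(ρ))) div u`;
* `hsEuler_weightB_transport` — `∂ₜB + u·∇B + B div u = (2/3) ζ(ρ) B div u`;
* `hsEuler_coeffRho_partialDeriv` — `∂ᵢ(θ γ(ρ)) = ∂ᵢθ γ(ρ) + θ (2ζ'(ρ) + ρ ζ''(ρ)) ∂ᵢρ`;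
* `hsEuler_coeffTheta_partialDeriv` — `∂ᵢ(ρ ζ(ρ)) = γ(ρ) ∂ᵢρ`,

so that each coefficient is a multiple of `div u`, `∇ρ`, `∇θ` with a factor that is a smooth
function of `(ρ, θ)` — the Type I structure of the budget. The transport identities follow from
the primitive equations `D_t ρ = -ρ div u` (`hsEuler_density_eq`) and
`D_t θ = -(2/3) θ ζ(ρ) div u` (`hsEuler_temperature_eq`) by the chain, product and quotient rules
along time slices (`Torus.IsSmoothSpaceTimeOn.hasDerivWithinAt_slice`) and coordinate lines
(`hasDerivAt_coordLine`, `hasDerivAt_coordLine_comp`), closed by `field_simp`/`ring`.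
-/

noncomputable section

namespace Summit.AtomisticToContinuum.HydrodynamicLimit.Theorems

open Set Filter Topology MeasureTheory
open scoped ContDiff
open Literature.MathematicalPhysics.KineticTheory Literature.Analysis.FunctionSpaces

section WeightTransport

/-! ### Gradients of the pressure coefficients -/

/-- `∂ᵢ(a ζ(a)) = (ζ(a) + a ζ'(a)) ∂ᵢa` along a `C¹` torus function `a`, at a point where `a` takes
values in an open set on which `ζ` is smooth. [folklore] -/
theorem partialDeriv_self_mul_comp {a : T3 → ℝ} (ha : Torus.IsContDiff 1 a) {ζ : ℝ → ℝ}
    {J : Set ℝ} (hJ : IsOpen J) (hζ : ContDiffOn ℝ ∞ ζ J) (x : T3) (hx : a x ∈ J) (i : Fin 3) :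
    Torus.partialDeriv i (fun y => a y * ζ (a y)) x =
      (ζ (a x) + a x * deriv ζ (a x)) * Torus.partialDeriv i a x :=
  partialDeriv_eq_of_hasDerivAt (((hasDerivAt_coordLine ha x i).fun_mul
    (hasDerivAt_coordLine_comp ha hJ hζ x hx i)).congr_deriv
    (by simp only [zero_smul, Torus.proj_zero, add_zero]; ring))

/-- `∂ᵢ(b γ(a)) = ∂ᵢb γ(a) + b γ'(a) ∂ᵢa` with `γ = ζ + id·ζ'`, `γ' = 2ζ' + id·ζ''`, along `C¹`
torus functions `a, b`, at a point where `a` takes values in an open set on which `ζ` is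
smooth. [folklore] -/
theorem partialDeriv_mul_gamma_comp {a b : T3 → ℝ} (ha : Torus.IsContDiff 1 a)
    (hb : Torus.IsContDiff 1 b) {ζ : ℝ → ℝ} {J : Set ℝ} (hJ : IsOpen J) (hζ : ContDiffOn ℝ ∞ ζ J)
    (x : T3) (hx : a x ∈ J) (i : Fin 3) :
    Torus.partialDeriv i (fun y => b y * (ζ (a y) + a y * deriv ζ (a y))) x =
      Torus.partialDeriv i b x * (ζ (a x) + a x * deriv ζ (a x)) +
        b x * (2 * deriv ζ (a x) + a x * deriv (deriv ζ) (a x)) * Torus.partialDeriv i a x :=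
  partialDeriv_eq_of_hasDerivAt (((hasDerivAt_coordLine hb x i).fun_mul
    ((hasDerivAt_coordLine_comp ha hJ hζ x hx i).fun_add ((hasDerivAt_coordLine ha x i).fun_mul
      (hasDerivAt_coordLine_comp ha hJ (hζ.deriv_of_isOpen (m := ∞) hJ le_rfl) x hx
        i)))).congr_deriv
    (by simp only [zero_smul, Torus.proj_zero, add_zero]; ring))

/-- **Gradient of the density coefficient `θ γ(ρ) = ∂_ρ p`** along a classical hard-sphere–Euler
solution with density valued in an open set on which `ζ` is smooth:
`∂ᵢ(θ (ζ(ρ) + ρ ζ'(ρ))) = ∂ᵢθ (ζ(ρ) + ρ ζ'(ρ)) + θ (2ζ'(ρ) + ρ ζ''(ρ)) ∂ᵢρ` pointwise on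
`[0, T) × 𝕋³`. [folklore] -/
theorem hsEuler_coeffRho_partialDeriv :
    ∀ {σ T : ℝ} {ρ θ : ℝ → T3 → ℝ} {u : ℝ → T3 → V3} {ζ : ℝ → ℝ} {J : Set ℝ},
      IsHardSphereEulerSolution σ T ρ u θ → IsOpen J → ContDiffOn ℝ (⊤ : ℕ∞) ζ J →
      (∀ t ∈ Ico 0 T, ∀ x, ρ t x ∈ J) → ∀ {t : ℝ}, t ∈ Ico 0 T → ∀ x : T3, ∀ i : Fin 3,
        Torus.partialDeriv i (fun y => θ t y * (ζ (ρ t y) + ρ t y * deriv ζ (ρ t y))) x =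
          Torus.partialDeriv i (θ t) x * (ζ (ρ t x) + ρ t x * deriv ζ (ρ t x)) +
            θ t x * (2 * deriv ζ (ρ t x) + ρ t x * deriv (deriv ζ) (ρ t x)) *
              Torus.partialDeriv i (ρ t) x := by
  intro σ T ρ θ u ζ J hE hJ hζ hρJ t ht x i
  exact partialDeriv_mul_gamma_comp ((hE.smooth_density.isSmooth_slice ht).isContDiff (by simp))
    ((hE.smooth_temperature.isSmooth_slice ht).isContDiff (by simp)) hJ hζ x (hρJ t ht x) i

/-- **Gradient of the temperature coefficient `ρ ζ(ρ) = ∂_θ p`** along a classical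
hard-sphere–Euler solution with density valued in an open set on which `ζ` is smooth:
`∂ᵢ(ρ ζ(ρ)) = (ζ(ρ) + ρ ζ'(ρ)) ∂ᵢρ` pointwise on `[0, T) × 𝕋³`. [folklore] -/
theorem hsEuler_coeffTheta_partialDeriv :
    ∀ {σ T : ℝ} {ρ θ : ℝ → T3 → ℝ} {u : ℝ → T3 → V3} {ζ : ℝ → ℝ} {J : Set ℝ},
      IsHardSphereEulerSolution σ T ρ u θ → IsOpen J → ContDiffOn ℝ (⊤ : ℕ∞) ζ J →
      (∀ t ∈ Ico 0 T, ∀ x, ρ t x ∈ J) → ∀ {t : ℝ}, t ∈ Ico 0 T → ∀ x : T3, ∀ i : Fin 3,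
        Torus.partialDeriv i (fun y => ρ t y * ζ (ρ t y)) x =
          (ζ (ρ t x) + ρ t x * deriv ζ (ρ t x)) * Torus.partialDeriv i (ρ t) x := by
  intro σ T ρ θ u ζ J hE hJ hζ hρJ t ht x i
  exact partialDeriv_self_mul_comp ((hE.smooth_density.isSmooth_slice ht).isContDiff (by simp))
    hJ hζ x (hρJ t ht x) i

/-! ### Transport of the weights -/

/-- **Transport of the weight `B = 3ρ/(2θ)`** along a classical hard-sphere–Euler solution with
pressure `ρ θ ζ(ρ)`: `∂ₜB + u·∇B + B div u = (2/3) ζ(ρ) B div u` pointwise on `[0, T) × 𝕋³`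
(from `D_t ρ = -ρ div u` and `D_t θ = -(2/3) θ ζ(ρ) div u`: `D_t B = B (-1 + (2/3) ζ(ρ)) div u`).
[folklore] -/
theorem hsEuler_weightB_transport :
    ∀ {σ T : ℝ} {ρ θ : ℝ → T3 → ℝ} {u : ℝ → T3 → V3} {ζ : ℝ → ℝ} {J : Set ℝ},
      IsHardSphereEulerSolution σ T ρ u θ → IsOpen J → ContDiffOn ℝ (⊤ : ℕ∞) ζ J →
      (∀ t ∈ Ico 0 T, ∀ x, ρ t x ∈ J) →
      (∀ t ∈ Ico 0 T, ∀ x, hsPressure σ (ρ t x) (θ t x) = ρ t x * θ t x * ζ (ρ t x)) →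
      ∀ {t : ℝ}, t ∈ Ico 0 T → ∀ x : T3,
        Torus.timeDerivWithin (Ico 0 T) (fun s y => 3 / 2 * ρ s y / θ s y) t x +
              ∑ i, u t x i * Torus.partialDeriv i (fun y => 3 / 2 * ρ t y / θ t y) x +
            3 / 2 * ρ t x / θ t x * ∑ i, Torus.partialDeriv i (fun y => u t y i) x =
          2 / 3 * ζ (ρ t x) * (3 / 2 * ρ t x / θ t x) *
            ∑ i, Torus.partialDeriv i (fun y => u t y i) x := by
  intro σ T ρ θ u ζ J hE hJ hζ hρJ hp t ht x
  have hU : UniqueDiffOn ℝ (Ico (0 : ℝ) T) := uniqueDiffOn_Ico 0 T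
  have hρ1 : Torus.IsContDiff 1 (ρ t) := (hE.smooth_density.isSmooth_slice ht).isContDiff (by simp)
  have hθ1 : Torus.IsContDiff 1 (θ t) :=
    (hE.smooth_temperature.isSmooth_slice ht).isContDiff (by simp)
  have hθ0 : θ t x ≠ 0 := (hE.temperature_pos t ht x).ne'
  have hθ0' : ∀ i : Fin 3,
      θ t (x + Torus.proj ((0 : ℝ) • EuclideanSpace.single i (1 : ℝ))) ≠ 0 := by
    intro i; simpa using hθ0
  -- the time derivative of `B` (quotient rule along the time slice)
  rw [timeDerivWithin_eq_of_hasDerivWithinAt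
    (((hE.smooth_density.hasDerivWithinAt_slice ht x).const_mul (3 / 2)).fun_div
      (hE.smooth_temperature.hasDerivWithinAt_slice ht x) hθ0) (hU t ht)]
  -- the gradient of `B` (quotient rule along coordinate lines)
  have hB : ∀ i, Torus.partialDeriv i (fun y => 3 / 2 * ρ t y / θ t y) x =
      3 / 2 * (Torus.partialDeriv i (ρ t) x * θ t x - ρ t x * Torus.partialDeriv i (θ t) x) /
        θ t x ^ 2 := by
    intro i
    exact partialDeriv_eq_of_hasDerivAt ((((hasDerivAt_coordLine hρ1 x i).const_mul
      (3 / 2)).fun_div (hasDerivAt_coordLine hθ1 x i) (hθ0' i)).congr_deriv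
      (by simp only [zero_smul, Torus.proj_zero, add_zero]; ring))
  simp only [hB]
  -- substitute the primitive equations and close by algebra
  have hP1 := hsEuler_density_eq hE ht x
  have hP3 := hsEuler_temperature_eq hE hJ hζ hρJ hp ht x
  simp only [Fin.sum_univ_three] at hP1 hP3 ⊢
  rw [hP1, hP3]
  field_simp
  ring

/-- **Transport of the weight `A = θ γ(ρ)/ρ`** (`γ = ζ + id·ζ'`) along a classical
hard-sphere–Euler solution with pressure `ρ θ ζ(ρ)`:
`∂ₜA + u·∇A + A div u = (A (2 - (2/3) ζ(ρ)) - θ (2 ζ'(ρ) + ρ ζ''(ρ))) div u` pointwise on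
`[0, T) × 𝕋³` (from `D_t ρ = -ρ div u`, `D_t θ = -(2/3) θ ζ(ρ) div u` and the chain rule
`D_t γ(ρ) = γ'(ρ) D_t ρ`: `D_t A = (A - (2/3) ζ(ρ) A - θ γ'(ρ)) div u`; for the ideal gas `ζ ≡ 1`
this is `(4/3) A div u`). [folklore] -/
theorem hsEuler_weightA_transport :
    ∀ {σ T : ℝ} {ρ θ : ℝ → T3 → ℝ} {u : ℝ → T3 → V3} {ζ : ℝ → ℝ} {J : Set ℝ},
      IsHardSphereEulerSolution σ T ρ u θ → IsOpen J → ContDiffOn ℝ (⊤ : ℕ∞) ζ J →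
      (∀ t ∈ Ico 0 T, ∀ x, ρ t x ∈ J) →
      (∀ t ∈ Ico 0 T, ∀ x, hsPressure σ (ρ t x) (θ t x) = ρ t x * θ t x * ζ (ρ t x)) →
      ∀ {t : ℝ}, t ∈ Ico 0 T → ∀ x : T3,
        Torus.timeDerivWithin (Ico 0 T)
                (fun s y => θ s y * (ζ (ρ s y) + ρ s y * deriv ζ (ρ s y)) / ρ s y) t x +
              ∑ i, u t x i * Torus.partialDeriv i
                (fun y => θ t y * (ζ (ρ t y) + ρ t y * deriv ζ (ρ t y)) / ρ t y) x +
            θ t x * (ζ (ρ t x) + ρ t x * deriv ζ (ρ t x)) / ρ t x *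
              ∑ i, Torus.partialDeriv i (fun y => u t y i) x =
          (θ t x * (ζ (ρ t x) + ρ t x * deriv ζ (ρ t x)) / ρ t x * (2 - 2 / 3 * ζ (ρ t x)) -
              θ t x * (2 * deriv ζ (ρ t x) + ρ t x * deriv (deriv ζ) (ρ t x))) *
            ∑ i, Torus.partialDeriv i (fun y => u t y i) x := by
  intro σ T ρ θ u ζ J hE hJ hζ hρJ hp t ht x
  have hU : UniqueDiffOn ℝ (Ico (0 : ℝ) T) := uniqueDiffOn_Ico 0 T
  have hρ1 : Torus.IsContDiff 1 (ρ t) := (hE.smooth_density.isSmooth_slice ht).isContDiff (by simp)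
  have hθ1 : Torus.IsContDiff 1 (θ t) :=
    (hE.smooth_temperature.isSmooth_slice ht).isContDiff (by simp)
  have hζ' : ContDiffOn ℝ ∞ (deriv ζ) J := hζ.deriv_of_isOpen (m := ∞) hJ le_rfl
  have hρ0 : ρ t x ≠ 0 := (hE.density_pos t ht x).ne'
  have hxJ : ρ t x ∈ J := hρJ t ht x
  -- chain rules along the time slice: `∂ₜ ζ(ρ) = ζ'(ρ) ∂ₜρ`, `∂ₜ ζ'(ρ) = ζ''(ρ) ∂ₜρ`
  have hd1 : HasDerivAt ζ (deriv ζ (ρ t x)) (ρ t x) :=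
    ((hζ.differentiableOn (by simp)).differentiableAt (hJ.mem_nhds hxJ)).hasDerivAt
  have hd2 : HasDerivAt (deriv ζ) (deriv (deriv ζ) (ρ t x)) (ρ t x) :=
    ((hζ'.differentiableOn (by simp)).differentiableAt (hJ.mem_nhds hxJ)).hasDerivAt
  have sρ := hE.smooth_density.hasDerivWithinAt_slice ht x
  have sθ := hE.smooth_temperature.hasDerivWithinAt_slice ht x
  have sζ : HasDerivWithinAt (fun τ => ζ (ρ τ x))
      (deriv ζ (ρ t x) * Torus.timeDerivWithin (Ico 0 T) ρ t x) (Ico 0 T) t := by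
    have h := hd1.comp_hasDerivWithinAt t sρ
    exact h
  have sζd : HasDerivWithinAt (fun τ => deriv ζ (ρ τ x))
      (deriv (deriv ζ) (ρ t x) * Torus.timeDerivWithin (Ico 0 T) ρ t x) (Ico 0 T) t := by
    have h := hd2.comp_hasDerivWithinAt t sρ
    exact h
  -- the time derivative of `A` (product and quotient rules along the time slice)
  rw [timeDerivWithin_eq_of_hasDerivWithinAt
    ((sθ.fun_mul (sζ.fun_add (sρ.fun_mul sζd))).fun_div sρ hρ0) (hU t ht)]
  -- the gradient of `A` (chain, product and quotient rules along coordinate lines)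
  have hρ0' : ∀ i : Fin 3,
      ρ t (x + Torus.proj ((0 : ℝ) • EuclideanSpace.single i (1 : ℝ))) ≠ 0 := by
    intro i; simpa using hρ0
  have hA : ∀ i, Torus.partialDeriv i
      (fun y => θ t y * (ζ (ρ t y) + ρ t y * deriv ζ (ρ t y)) / ρ t y) x =
      (Torus.partialDeriv i (θ t) x * (ζ (ρ t x) + ρ t x * deriv ζ (ρ t x)) * ρ t x +
          θ t x * (2 * deriv ζ (ρ t x) + ρ t x * deriv (deriv ζ) (ρ t x)) *
            Torus.partialDeriv i (ρ t) x * ρ t x -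
          θ t x * (ζ (ρ t x) + ρ t x * deriv ζ (ρ t x)) * Torus.partialDeriv i (ρ t) x) /
        ρ t x ^ 2 := by
    intro i
    exact partialDeriv_eq_of_hasDerivAt ((((hasDerivAt_coordLine hθ1 x i).fun_mul
      ((hasDerivAt_coordLine_comp hρ1 hJ hζ x hxJ i).fun_add ((hasDerivAt_coordLine hρ1 x i).fun_mul
        (hasDerivAt_coordLine_comp hρ1 hJ hζ' x hxJ i)))).fun_div (hasDerivAt_coordLine hρ1 x i)
      (hρ0' i)).congr_deriv (by simp only [zero_smul, Torus.proj_zero, add_zero]; ring))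
  simp only [hA]
  -- substitute the primitive equations and close by algebra
  have hP1 := hsEuler_density_eq hE ht x
  have hP3 := hsEuler_temperature_eq hE hJ hζ hρJ hp ht x
  simp only [Fin.sum_univ_three] at hP1 hP3 ⊢
  rw [hP1, hP3]
  field_simp
  ring

end WeightTransport

end Summit.AtomisticToContinuum.HydrodynamicLimit.Theorems

end
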